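import Literature.NumberTheory.Automorphic.ArchLocalRelabelTransport           -- ★ p840351: brings ★ `GLn.conjEquiv`, `formCongr`, `conj_mem_unitaryGroupOfForm_iff`, `archLocal`, `circleDiagonal`
import Mathlib.MeasureTheory.Integral.Bochner.Basic
import Mathlib.Analysis.Calculus.ContDiff.Operations
import Mathlib.Analysis.SpecialFunctions.Sqrt
import HarnessLib

/-!
# Torus-fixing congruences between the archimedean unitary groups `U(σ_w diag α)(ℂ)` and `U(σ_w diag α′)(ℂ)` — in particular the diagonal RESCALING
# `D = diag(√(α₀∕α₁), √(α₁∕α₀), 1)`, `U(σ_w diag α) ≃ U(σ_w diag(α ∘ (0 1)))` — carrying torus points to THEMSELVES and torus orbital integrals to torus orbital integrals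
(ROAD-Sd R1 (R1-d)(b2′) glue; Rogawski 1990 §3.7 Prop. 3.7.1, §8.2 p. 122; Platonov–Rapinchuk §2.3)

Topic `NumberTheory/Automorphic`; namespace `Literature.NumberTheory.Automorphic.UnitaryGroup`.  THEOREMS ONLY (no `def`, no instance, no notation, no axiom, no named fact, no `sorry`).
Cell `pub/hodgecm-mathlib`, ENGINE T1 (crux H413 = `stmt-HodgeConjecture-24833`); FILE A (congruence algebra) of the (R1-d)(b2′) brick (FILE B = ★ `Rogawski1990/ArchLimitFormulaNoncompactWallConstRescale`:
the (J-nc) constant transported across the two noncompact wall classes; LEAD F0P3a-plan (g9) WORD T8-111); author F0P3a-p02 (g11), 2026-09-01.  Twin of ★ p840351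
`ArchLocalRelabelTransport` (permutation matrices `M(σ)`, which MOVE torus points `diag z ↦ diag (z∘σ⁻¹)`) for congruences `T` which FIX them.

WHY.  At a complex place `w` where `U(σ_w diag α) ≅ U(2,1)` has two NONCOMPACT walls (`re σα₀·re σα₂ < 0`, `re σα₁·re σα₂ < 0`, hence `re σα₀·re σα₁ > 0`) the two wall classes `{α₀,α₂}` and
`{α₁,α₂}` are exchanged by NO relabelling inside one frame, but the DIAGONAL rescaling `D = diag(√(re σα₀∕re σα₁), √(re σα₁∕re σα₀), 1)` satisfies `Dᴴ·σ_w diag(α∘(0 1))·D = σ_w diag α`, so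
`Ad(D) : U(σ_w diag α) ≃ₜ* U(σ_w diag(α∘(0 1)))` (★ `conj_mem_unitaryGroupOfForm_iff`, ★ `GLn.conjEquiv`, no new definition: the iso is the TERM `ContinuousMulEquiv.restrictSubgroup (GLn.conjEquiv T) …`),
and `D·diag z·D⁻¹ = diag z`: the standard `{0,2}`-wall curve of `G_w(α)` (class `{α₀,α₂}`) IS the standard curve of `G_w(α∘(0 1))` (class `{α₁,α₂}`).

WHAT IS PROVED.
§1 (any `N`, any `T ∈ GL_N(ℂ)` with `hcongr : formCongr conj T (σ_w diag α′) = σ_w diag α`, `htorus : ∀ z, T·diag z·T⁻¹ = diag z`): `mem_archLocal_diagonal_iff_conjEquiv_mem_of_formCongr_eq` (the hypothesis of ★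
   `ContinuousMulEquiv.restrictSubgroup` making `GLn.conjEquiv T` restrict to `e_T : G_w(α) ≃ₜ* G_w(α′)`), `coe_congrT_apply` (`rfl`), **`congrT_circleDiagonal`** (`e_T (diag z) = diag z`),
   `congrT_conj_circleDiagonal`, **`integral_comp_conj_circleDiagonal_eq_integral_map_congrT`** (`∫_{G_w(α′)} f(g′·diag z·g′⁻¹) d(e_T_*ν) = ∫_{G_w(α)} f(e_T(g·diag z·g⁻¹)) dν`),
   `apply_coe_congrT` (`Θ ↑↑(e_T x) = Θ(T·↑↑x·T⁻¹)`), `contDiff_comp_units_conj`, `hasCompactSupport_comp_congrT`.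
§2 (`N = 3`) the rescaling `D`: `det_rescale01_ne_zero`, **`formCongr_rescale01_map_diagonal`** (`Dᴴ·σ_w diag(α∘(0 1))·D = σ_w diag α` under `hreal` and `0 < re σα₀·re σα₁`),
   **`rescale01_conj_circleDiagonal`** (`D·diag z·D⁻¹ = diag z`) — the `hcongr`∕`htorus` inputs of FILE B at `T := D`, `α′ := α ∘ (0 1)`.
HONEST LABEL: HC_CM is proved only modulo the printed citations until rung 0 closes; this file is linear algebra ∕ change of variables and pays nothing by itself.

## References
* [Rogawski1990] J. D. Rogawski, *Automorphic Representations of Unitary Groups in Three Variables*, Ann. of Math. Stud. 123 (1990), §3.7 Prop. 3.7.1 pp. 29–30, §8.2 p. 122.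
* [PlatonovRapinchuk1994] V. Platonov, A. Rapinchuk, *Algebraic Groups and Number Theory* (1994), §2.3 (congruent hermitian forms have conjugate unitary groups).
* [DeitmarEchterhoff2014] A. Deitmar, S. Echterhoff, *Principles of Harmonic Analysis*, 2nd ed. (2014), Thm. 1.5.3.
-/

set_option autoImplicit false

noncomputable section

open MeasureTheory Measure Filter Topology NumberField NumberField.InfinitePlace Matrix Equiv
open scoped Matrix MatrixGroups Matrix.Norms.Operator ComplexConjugate

/-! ## §1 A torus-fixing congruence `e_T : G_w(α) ≃ₜ* G_w(α′)` and its transport lemmas -/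

namespace Literature.NumberTheory.Automorphic.UnitaryGroup

section CongrT

variable (L : Type) [Field L] (N : ℕ) (α α' : Fin N → L) (w : {w : InfinitePlace L // IsComplex w}) (T : GL (Fin N) ℂ)
  (hcongr : formCongr (starRingEnd ℂ) T ((Matrix.diagonal α').map w.1.embedding) = (Matrix.diagonal α).map w.1.embedding)

include hcongr in
/-- **`g ∈ G_w(α) ↔ T g T⁻¹ ∈ G_w(α′)`** for a congruence `Tᴴ·σ_w diag α′·T = σ_w diag α` (★ `conj_mem_unitaryGroupOfForm_iff`): the hypothesis of ★ `ContinuousMulEquiv.restrictSubgroup` making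
`GLn.conjEquiv T` restrict to `e_T : G_w(α) ≃ₜ* G_w(α′)`. [cite: PlatonovRapinchuk1994, §2.3] -/
theorem mem_archLocal_diagonal_iff_conjEquiv_mem_of_formCongr_eq (g : GL (Fin N) ℂ) :
    g ∈ archLocal L N (Matrix.diagonal α) w ↔ GLn.conjEquiv T g ∈ archLocal L N (Matrix.diagonal α') w := by
  rw [GLn.conjEquiv_apply]
  show g ∈ unitaryGroupOfForm (starRingEnd ℂ) ((Matrix.diagonal α).map w.1.embedding) ↔
    _ ∈ unitaryGroupOfForm (starRingEnd ℂ) ((Matrix.diagonal α').map w.1.embedding)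
  rw [conj_mem_unitaryGroupOfForm_iff, hcongr]

/-- `e_T g = T g T⁻¹` on underlying invertible matrices (definitional). [cite: PlatonovRapinchuk1994, §2.3] -/
theorem coe_congrT_apply (g : archLocal L N (Matrix.diagonal α) w) :
    (((ContinuousMulEquiv.restrictSubgroup (GLn.conjEquiv T) (archLocal L N (Matrix.diagonal α) w) (archLocal L N (Matrix.diagonal α') w)
        (mem_archLocal_diagonal_iff_conjEquiv_mem_of_formCongr_eq L N α α' w T hcongr)) g : archLocal L N (Matrix.diagonal α') w) : GL (Fin N) ℂ) =
      T * (g : GL (Fin N) ℂ) * T⁻¹ :=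
  rfl

variable (htorus : ∀ z : Fin N → Circle, T * circleDiagonal N z * T⁻¹ = circleDiagonal N z)

include htorus in
/-- **A TORUS-FIXING CONGRUENCE FIXES THE TORUS POINTS**: `e_T (diag z) = diag z` (e.g. `T` diagonal). [cite: Rogawski1990, §3.7 Prop. 3.7.1 pp. 29–30] -/
theorem congrT_circleDiagonal (z : Fin N → Circle) :
    (ContinuousMulEquiv.restrictSubgroup (GLn.conjEquiv T) (archLocal L N (Matrix.diagonal α) w) (archLocal L N (Matrix.diagonal α') w)
        (mem_archLocal_diagonal_iff_conjEquiv_mem_of_formCongr_eq L N α α' w T hcongr))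
        ⟨circleDiagonal N z, circleDiagonal_mem_archLocal_diagonal L N α w z⟩ =
      ⟨circleDiagonal N z, circleDiagonal_mem_archLocal_diagonal L N α' w z⟩ := by
  apply Subtype.ext
  rw [coe_congrT_apply L N α α' w T hcongr]
  exact htorus z

include htorus in
/-- `e_T (g · diag z · g⁻¹) = e_T g · diag z · (e_T g)⁻¹`. [cite: Rogawski1990, §8.2 p. 122] -/
theorem congrT_conj_circleDiagonal (g : archLocal L N (Matrix.diagonal α) w) (z : Fin N → Circle) :
    (ContinuousMulEquiv.restrictSubgroup (GLn.conjEquiv T) (archLocal L N (Matrix.diagonal α) w) (archLocal L N (Matrix.diagonal α') w)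
        (mem_archLocal_diagonal_iff_conjEquiv_mem_of_formCongr_eq L N α α' w T hcongr))
        (g * ⟨circleDiagonal N z, circleDiagonal_mem_archLocal_diagonal L N α w z⟩ * g⁻¹) =
      (ContinuousMulEquiv.restrictSubgroup (GLn.conjEquiv T) (archLocal L N (Matrix.diagonal α) w) (archLocal L N (Matrix.diagonal α') w)
        (mem_archLocal_diagonal_iff_conjEquiv_mem_of_formCongr_eq L N α α' w T hcongr)) g *
        ⟨circleDiagonal N z, circleDiagonal_mem_archLocal_diagonal L N α' w z⟩ *
        ((ContinuousMulEquiv.restrictSubgroup (GLn.conjEquiv T) (archLocal L N (Matrix.diagonal α) w) (archLocal L N (Matrix.diagonal α') w)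
        (mem_archLocal_diagonal_iff_conjEquiv_mem_of_formCongr_eq L N α α' w T hcongr)) g)⁻¹ := by
  rw [map_mul, map_mul, map_inv, congrT_circleDiagonal L N α α' w T hcongr htorus]

include htorus in
/-- **TRANSPORT OF THE TORUS ORBITAL INTEGRAL ALONG `e_T`**: `∫_{G_w(α′)} f(g′·diag z·g′⁻¹) d(e_T_*ν)(g′) = ∫_{G_w(α)} f(e_T(g·diag z·g⁻¹)) dν(g)` for every `f`, `ν`, `z`
(change of variables along the homeomorphism; the torus point is FIXED). [cite: Rogawski1990, §8.2 p. 122] [cite: DeitmarEchterhoff2014, Thm. 1.5.3] -/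
theorem integral_comp_conj_circleDiagonal_eq_integral_map_congrT {E : Type*} [NormedAddCommGroup E] [NormedSpace ℝ E]
    [MeasurableSpace (archLocal L N (Matrix.diagonal α) w)] [BorelSpace (archLocal L N (Matrix.diagonal α) w)]
    [MeasurableSpace (archLocal L N (Matrix.diagonal α') w)] [BorelSpace (archLocal L N (Matrix.diagonal α') w)]
    (ν : Measure (archLocal L N (Matrix.diagonal α) w)) (f : archLocal L N (Matrix.diagonal α') w → E) (z : Fin N → Circle) :
    ∫ g', f (g' * ⟨circleDiagonal N z, circleDiagonal_mem_archLocal_diagonal L N α' w z⟩ * g'⁻¹)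
        ∂(ν.map (ContinuousMulEquiv.restrictSubgroup (GLn.conjEquiv T) (archLocal L N (Matrix.diagonal α) w) (archLocal L N (Matrix.diagonal α') w)
          (mem_archLocal_diagonal_iff_conjEquiv_mem_of_formCongr_eq L N α α' w T hcongr))) =
      ∫ g, f ((ContinuousMulEquiv.restrictSubgroup (GLn.conjEquiv T) (archLocal L N (Matrix.diagonal α) w) (archLocal L N (Matrix.diagonal α') w)
          (mem_archLocal_diagonal_iff_conjEquiv_mem_of_formCongr_eq L N α α' w T hcongr)) (g * ⟨circleDiagonal N z, circleDiagonal_mem_archLocal_diagonal L N α w z⟩ * g⁻¹)) ∂ν := by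
  set e := (ContinuousMulEquiv.restrictSubgroup (GLn.conjEquiv T) (archLocal L N (Matrix.diagonal α) w) (archLocal L N (Matrix.diagonal α') w)
          (mem_archLocal_diagonal_iff_conjEquiv_mem_of_formCongr_eq L N α α' w T hcongr)) with he
  have hmap : ν.map e = ν.map e.toHomeomorph.toMeasurableEquiv := rfl
  have hcoe : ∀ g, e.toHomeomorph.toMeasurableEquiv g = e g := fun _ => rfl
  rw [hmap, integral_map_equiv]
  refine integral_congr_ae (Filter.Eventually.of_forall fun g => ?_)
  dsimp only
  rw [hcoe, he, congrT_conj_circleDiagonal L N α α' w T hcongr htorus]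

/-- On underlying matrices `e_T` is `A ↦ T A T⁻¹`: `Θ ↑↑(e_T x) = Θ (T · ↑↑x · T⁻¹)`. [cite: PlatonovRapinchuk1994, §2.3] -/
theorem apply_coe_congrT {E : Type*} (Θ : Matrix (Fin N) (Fin N) ℂ → E) (x : archLocal L N (Matrix.diagonal α) w) :
    Θ ((((ContinuousMulEquiv.restrictSubgroup (GLn.conjEquiv T) (archLocal L N (Matrix.diagonal α) w) (archLocal L N (Matrix.diagonal α') w)
        (mem_archLocal_diagonal_iff_conjEquiv_mem_of_formCongr_eq L N α α' w T hcongr)) x : archLocal L N (Matrix.diagonal α') w) : GL (Fin N) ℂ) : Matrix (Fin N) (Fin N) ℂ) =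
      Θ ((T : Matrix (Fin N) (Fin N) ℂ) * ((x : GL (Fin N) ℂ) : Matrix (Fin N) (Fin N) ℂ) * ((T⁻¹ : GL (Fin N) ℂ) : Matrix (Fin N) (Fin N) ℂ)) := by
  rw [coe_congrT_apply L N α α' w T hcongr, Units.val_mul, Units.val_mul]

omit hcongr in
/-- The transported ambient function `A ↦ Θ (T A T⁻¹)` is `C^n` when `Θ` is (composition with a continuous linear map). [cite: PlatonovRapinchuk1994, §2.3] -/
theorem contDiff_comp_units_conj {E : Type*} [NormedAddCommGroup E] [NormedSpace ℝ E] {n : WithTop ℕ∞}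
    (Θ : Matrix (Fin N) (Fin N) ℂ → E) (hΘ : ContDiff ℝ n Θ) :
    ContDiff ℝ n fun A : Matrix (Fin N) (Fin N) ℂ => Θ ((T : Matrix (Fin N) (Fin N) ℂ) * A * ((T⁻¹ : GL (Fin N) ℂ) : Matrix (Fin N) (Fin N) ℂ)) :=
  hΘ.comp ((contDiff_const.mul contDiff_id).mul contDiff_const)

include hcongr in
/-- Compact support on the group is carried back along `e_T`: if `k′ ↦ Θ ↑↑k′` has compact support on `G_w(α′)`, then `k ↦ Θ(T·↑↑k·T⁻¹) = Θ ↑↑(e_T k)` has compact support on `G_w(α)`.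
[cite: PlatonovRapinchuk1994, §2.3] -/
theorem hasCompactSupport_comp_congrT {E : Type*} [Zero E] [TopologicalSpace E] (Θ : Matrix (Fin N) (Fin N) ℂ → E)
    (hΘc : HasCompactSupport (fun k : archLocal L N (Matrix.diagonal α') w => Θ ((k : GL (Fin N) ℂ) : Matrix (Fin N) (Fin N) ℂ))) :
    HasCompactSupport (fun k : archLocal L N (Matrix.diagonal α) w =>
      Θ ((T : Matrix (Fin N) (Fin N) ℂ) * ((k : GL (Fin N) ℂ) : Matrix (Fin N) (Fin N) ℂ) * ((T⁻¹ : GL (Fin N) ℂ) : Matrix (Fin N) (Fin N) ℂ))) := by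
  have h := hΘc.comp_homeomorph (ContinuousMulEquiv.restrictSubgroup (GLn.conjEquiv T) (archLocal L N (Matrix.diagonal α) w) (archLocal L N (Matrix.diagonal α') w)
    (mem_archLocal_diagonal_iff_conjEquiv_mem_of_formCongr_eq L N α α' w T hcongr)).toHomeomorph
  have heq : ((fun k : archLocal L N (Matrix.diagonal α') w => Θ ((k : GL (Fin N) ℂ) : Matrix (Fin N) (Fin N) ℂ)) ∘
      ⇑(ContinuousMulEquiv.restrictSubgroup (GLn.conjEquiv T) (archLocal L N (Matrix.diagonal α) w) (archLocal L N (Matrix.diagonal α') w)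
        (mem_archLocal_diagonal_iff_conjEquiv_mem_of_formCongr_eq L N α α' w T hcongr)).toHomeomorph) =
      fun k : archLocal L N (Matrix.diagonal α) w => Θ ((T : Matrix (Fin N) (Fin N) ℂ) * ((k : GL (Fin N) ℂ) : Matrix (Fin N) (Fin N) ℂ) * ((T⁻¹ : GL (Fin N) ℂ) : Matrix (Fin N) (Fin N) ℂ)) := by
    funext k
    exact apply_coe_congrT L N α α' w T hcongr Θ k
  rw [heq] at h
  exact h

end CongrT

end Literature.NumberTheory.Automorphic.UnitaryGroup

/-! ## §2 The diagonal rescaling `D = diag(√(re σα₀ ∕ re σα₁), √(re σα₁ ∕ re σα₀), 1)`: a torus-fixing congruence `U(σ_w diag α) ≃ U(σ_w diag(α ∘ (0 1)))` -/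

namespace Literature.NumberTheory.Automorphic.UnitaryGroup

section Rescale

variable (L : Type) [Field L] (α : Fin 3 → L) (w : {w : InfinitePlace L // IsComplex w})

omit [Field L] in
/-- `det D ≠ 0` for the rescaling matrix (its entries are positive reals when `re σα₀ · re σα₁ > 0`). [cite: PlatonovRapinchuk1994, §2.3] -/
theorem det_rescale01_ne_zero {r₀ r₁ : ℝ} (h : 0 < r₀ * r₁) :
    (Matrix.diagonal ![((Real.sqrt (r₀ / r₁) : ℝ) : ℂ), ((Real.sqrt (r₁ / r₀) : ℝ) : ℂ), 1]).det ≠ 0 := by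
  have hq : 0 < r₀ / r₁ := by
    rcases mul_pos_iff.1 h with ⟨h0, h1⟩ | ⟨h0, h1⟩
    · exact div_pos h0 h1
    · exact div_pos_of_neg_of_neg h0 h1
  have hq' : 0 < r₁ / r₀ := by
    rcases mul_pos_iff.1 h with ⟨h0, h1⟩ | ⟨h0, h1⟩
    · exact div_pos h1 h0
    · exact div_pos_of_neg_of_neg h1 h0
  rw [Matrix.det_diagonal, Fin.prod_univ_three]
  simp only [Matrix.cons_val_zero, Matrix.cons_val_one, Matrix.cons_val_two, Matrix.head_cons, Matrix.tail_cons, mul_one]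
  exact mul_ne_zero (Complex.ofReal_ne_zero.2 (Real.sqrt_pos.2 hq).ne') (Complex.ofReal_ne_zero.2 (Real.sqrt_pos.2 hq').ne')

/-- **THE RESCALING CONGRUENCE**: `Dᴴ · σ_w diag(α ∘ (0 1)) · D = σ_w diag α` for `D = diag(√(re σα₀∕re σα₁), √(re σα₁∕re σα₀), 1)`, when the weights are real at `w` and `re σα₀ · re σα₁ > 0` (the two
positive — or two negative — lines can be exchanged after rescaling). [cite: PlatonovRapinchuk1994, §2.3] [cite: Rogawski1990, §3.7 Prop. 3.7.1 pp. 29–30] -/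
theorem formCongr_rescale01_map_diagonal (hreal : ∀ i, (w.1.embedding (α i)).im = 0) (h01 : 0 < (w.1.embedding (α 0)).re * (w.1.embedding (α 1)).re) :
    formCongr (starRingEnd ℂ)
        (Matrix.GeneralLinearGroup.mkOfDetNeZero (Matrix.diagonal ![((Real.sqrt ((w.1.embedding (α 0)).re / (w.1.embedding (α 1)).re) : ℝ) : ℂ),
          ((Real.sqrt ((w.1.embedding (α 1)).re / (w.1.embedding (α 0)).re) : ℝ) : ℂ), 1]) (det_rescale01_ne_zero h01))
        ((Matrix.diagonal (α ∘ ⇑(Equiv.swap (0 : Fin 3) 1))).map w.1.embedding) =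
      (Matrix.diagonal α).map w.1.embedding := by
  -- the weights are the real numbers `rᵢ`
  set r₀ : ℝ := (w.1.embedding (α 0)).re with hr₀
  set r₁ : ℝ := (w.1.embedding (α 1)).re with hr₁
  have hα0 : w.1.embedding (α 0) = (r₀ : ℂ) := Complex.ext (by simp [hr₀]) (by simp [hreal 0])
  have hα1 : w.1.embedding (α 1) = (r₁ : ℂ) := Complex.ext (by simp [hr₁]) (by simp [hreal 1])
  have hr0 : r₀ ≠ 0 := fun h => by rw [h, zero_mul] at h01; exact lt_irrefl _ h01
  have hr1 : r₁ ≠ 0 := fun h => by rw [h, mul_zero] at h01; exact lt_irrefl _ h01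
  have hq : 0 ≤ r₀ / r₁ := by
    rcases mul_pos_iff.1 h01 with ⟨h0, h1⟩ | ⟨h0, h1⟩
    · exact (div_pos h0 h1).le
    · exact (div_pos_of_neg_of_neg h0 h1).le
  have hq' : 0 ≤ r₁ / r₀ := by
    rcases mul_pos_iff.1 h01 with ⟨h0, h1⟩ | ⟨h0, h1⟩
    · exact (div_pos h1 h0).le
    · exact (div_pos_of_neg_of_neg h1 h0).le
  have hs0 : ((Real.sqrt (r₀ / r₁) : ℝ) : ℂ) * (r₁ : ℂ) * ((Real.sqrt (r₀ / r₁) : ℝ) : ℂ) = (r₀ : ℂ) := by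
    have h : Real.sqrt (r₀ / r₁) * r₁ * Real.sqrt (r₀ / r₁) = r₀ := by
      rw [mul_comm (Real.sqrt (r₀ / r₁)) r₁, mul_assoc, Real.mul_self_sqrt hq, mul_div_assoc']
      exact mul_div_cancel_left₀ r₀ hr1
    exact_mod_cast h
  have hs1 : ((Real.sqrt (r₁ / r₀) : ℝ) : ℂ) * (r₀ : ℂ) * ((Real.sqrt (r₁ / r₀) : ℝ) : ℂ) = (r₁ : ℂ) := by
    have h : Real.sqrt (r₁ / r₀) * r₀ * Real.sqrt (r₁ / r₀) = r₁ := by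
      rw [mul_comm (Real.sqrt (r₁ / r₀)) r₀, mul_assoc, Real.mul_self_sqrt hq', mul_div_assoc']
      exact mul_div_cancel_left₀ r₁ hr0
    exact_mod_cast h
  rw [formCongr, Matrix.GeneralLinearGroup.val_mkOfDetNeZero, Matrix.diagonal_map (map_zero _), Matrix.diagonal_map (map_zero _), Matrix.diagonal_map (map_zero _),
    Matrix.diagonal_transpose, Matrix.diagonal_mul_diagonal, Matrix.diagonal_mul_diagonal]
  congr 1
  funext i
  fin_cases i
  · simp [hα0, hα1, Equiv.swap_apply_left, hs0]
  · simp [hα0, hα1, Equiv.swap_apply_right, hs1]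
  · simp [Equiv.swap_apply_of_ne_of_ne]

/-- **THE RESCALING FIXES THE TORUS**: `D · diag z · D⁻¹ = diag z` (diagonal matrices commute). [cite: Rogawski1990, §3.7 Prop. 3.7.1 pp. 29–30] -/
theorem rescale01_conj_circleDiagonal (h01 : 0 < (w.1.embedding (α 0)).re * (w.1.embedding (α 1)).re) (z : Fin 3 → Circle) :
    Matrix.GeneralLinearGroup.mkOfDetNeZero (Matrix.diagonal ![((Real.sqrt ((w.1.embedding (α 0)).re / (w.1.embedding (α 1)).re) : ℝ) : ℂ),
          ((Real.sqrt ((w.1.embedding (α 1)).re / (w.1.embedding (α 0)).re) : ℝ) : ℂ), 1]) (det_rescale01_ne_zero h01) *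
        circleDiagonal 3 z *
        (Matrix.GeneralLinearGroup.mkOfDetNeZero (Matrix.diagonal ![((Real.sqrt ((w.1.embedding (α 0)).re / (w.1.embedding (α 1)).re) : ℝ) : ℂ),
          ((Real.sqrt ((w.1.embedding (α 1)).re / (w.1.embedding (α 0)).re) : ℝ) : ℂ), 1]) (det_rescale01_ne_zero h01))⁻¹ =
      circleDiagonal 3 z := by
  have hcomm : Matrix.GeneralLinearGroup.mkOfDetNeZero (Matrix.diagonal ![((Real.sqrt ((w.1.embedding (α 0)).re / (w.1.embedding (α 1)).re) : ℝ) : ℂ),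
          ((Real.sqrt ((w.1.embedding (α 1)).re / (w.1.embedding (α 0)).re) : ℝ) : ℂ), 1]) (det_rescale01_ne_zero h01) * circleDiagonal 3 z =
      circleDiagonal 3 z * Matrix.GeneralLinearGroup.mkOfDetNeZero (Matrix.diagonal ![((Real.sqrt ((w.1.embedding (α 0)).re / (w.1.embedding (α 1)).re) : ℝ) : ℂ),
          ((Real.sqrt ((w.1.embedding (α 1)).re / (w.1.embedding (α 0)).re) : ℝ) : ℂ), 1]) (det_rescale01_ne_zero h01) := by
    apply Units.ext
    rw [Units.val_mul, Units.val_mul, Matrix.GeneralLinearGroup.val_mkOfDetNeZero, coe_circleDiagonal, Matrix.diagonal_mul_diagonal, Matrix.diagonal_mul_diagonal]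
    congr 1
    funext i
    exact mul_comm _ _
  rw [hcomm, mul_inv_cancel_right]

end Rescale

end Literature.NumberTheory.Automorphic.UnitaryGroup

end
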